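import Summits.AtomisticToContinuum.BoseEinsteinCondensation.Theorems.BECCutLineWeakDisorderGroundStateRigidityLocBdd
import Summits.AtomisticToContinuum.BoseEinsteinCondensation.Theorems.BECCutLineWeakDisorderGroundStateRigidityFiniteEnergyLocBdd
import HarnessLib

/-!
# Crux `GroundStateRigidity` (stmt-AtomisticToContinuum-9072), line `Sketch`:
# class (a) at EVERY density and every `(N ≥ 1, L > 0)`

Supports (does not close) stmt-AtomisticToContinuum-9072 (lead c2). Companion of `…GroundStateRigidityLocBdd.lean`:
since `E₀(N, L) < ⊤` holds at EVERY `(N ≥ 1, L > 0)` for potentials locally bounded on `(0, ∞)`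
(`groundStateEnergy_ne_top_of_locBdd`, wave 2: a hard core of tiny diameter plus a constant dominates `v`,
and tiny hard spheres fit by Ruelle's cells), the finite-energy / low-density hypotheses of the class (a)
theorems disappear:

* `hasUniqueGroundState_of_essLocBdd'` — uniqueness of the closed-form ground state up to phase for every
  measurable `v` with `v ≤ C(r)` a.e. on `[r, ∞)` (all `r > 0`), at every `(N ≥ 1, L > 0)`;
* `rigid_of_essLocBdd'` — rigidity of near-minimisers at every such box;
* `groundStateRigidity_of_essLocBdd_allDensities` — **`GroundStateRigidity`'s conclusion at EVERY density
  `ρ > 0`, all `N ≥ 1`, for every measurable `v` essentially locally bounded on `(0, ∞)`** (no finite range,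
  no low density; arbitrary at `r → 0`) — the class (a) analogue of `groundStateRigidity_of_bounded`.

## References

* M. Reed, B. Simon, *Methods of Modern Mathematical Physics IV* (1978), §XIII.12 Thms XIII.46–47.
-/

noncomputable section

open MeasureTheory Filter Set
open scoped ENNReal NNReal Topology

namespace Summit.AtomisticToContinuum.BoseEinsteinCondensation.Theorems.GroundStateRigidity

open Literature.MathematicalPhysics.QuantumManyBody.BoseGas

/-- **Uniqueness for essentially locally bounded potentials at EVERY `(N ≥ 1, L > 0)`** — the
finite-energy hypothesis of `hasUniqueGroundState_of_essLocBdd` is automatic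
(`groundStateEnergy_ne_top_of_locBdd` for the pointwise-locally-bounded modification off a null set of
radii, `groundStateEnergy_congr_offNull`). [cite: ReedSimonIV1978, §XIII.12 Thm XIII.47] -/
theorem hasUniqueGroundState_of_essLocBdd' :
    ∀ (N : ℕ) (v : ℝ → ℝ≥0∞) (L : ℝ), 1 ≤ N → 0 < L → Measurable v →
      (∀ r : ℝ, 0 < r → ∃ C : ℝ≥0, ∀ᵐ s : ℝ, r ≤ s → v s ≤ C) → HasUniqueGroundState v N L := by
  intro N v L hN hL hv hlb
  obtain ⟨v', S, hv'm, hSm, hS0, hvv', hlb'⟩ := exists_locBdd_offNull hv hlb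
  have hE' : groundStateEnergy v' N L ≠ ⊤ := groundStateEnergy_ne_top_of_locBdd N v' L hN hL hv'm hlb'
  exact (hasUniqueGroundState_iff_offNull hSm hS0 hvv').2
    (hasUniqueGroundState_of_locBdd N v' L hN hL hv'm hlb' hE')

/-- **Rigidity of near-minimisers for essentially locally bounded potentials at EVERY `(N ≥ 1, L > 0)`**
(no finite-energy and no density hypothesis). [cite: ReedSimonIV1978, §XIII.12 Thm XIII.47] -/
theorem rigid_of_essLocBdd' :
    ∀ (N : ℕ) (v : ℝ → ℝ≥0∞) (L : ℝ), 1 ≤ N → 0 < L → Measurable v →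
      (∀ r : ℝ, 0 < r → ∃ C : ℝ≥0, ∀ᵐ s : ℝ, r ≤ s → v s ≤ C) →
      ∀ η : ℝ, 0 < η → ∃ δ : ℝ≥0∞, 0 < δ ∧ ∀ Ψ Φ : TrialState N L,
        energy v Ψ ≤ groundStateEnergy v N L + δ → energy v Φ ≤ groundStateEnergy v N L + δ →
        ∃ c : ℂ, ‖c‖ = 1 ∧ ∫⁻ X, (‖Ψ.ψ X - c * Φ.ψ X‖₊ : ℝ≥0∞) ^ 2 ≤ ENNReal.ofReal η :=
  fun N v L hN hL hv hlb =>
    stub_rigidityOfUnique stub_compactness v N L (hasUniqueGroundState_of_essLocBdd' N v L hN hL hv hlb)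

/-- **`GroundStateRigidity` at EVERY density for potentials essentially locally bounded on `(0, ∞)`.**
For every measurable `v` with `v ≤ C(r)` a.e. on `[r, ∞)` for every `r > 0` (no finite range, no low
density; arbitrary at `r → 0`), every `ρ > 0`, all `N ≥ 1` and every `η > 0` some `δ > 0` makes any two
`δ`-near-minimisers in the box of side `(N/ρ)^{1/3}` `η`-close in `L²` up to a phase (`rigid_of_essLocBdd'`).
[cite: ReedSimonIV1978, §XIII.12 Thms XIII.46–XIII.47] -/
theorem groundStateRigidity_of_essLocBdd_allDensities :
    ∀ v : ℝ → ℝ≥0∞, Measurable v →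
      (∀ r : ℝ, 0 < r → ∃ C : ℝ≥0, ∀ᵐ s : ℝ, r ≤ s → v s ≤ C) →
      ∀ ρ : ℝ, 0 < ρ → ∀ᶠ N : ℕ in atTop,
        ∀ η : ℝ, 0 < η → ∃ δ : ℝ≥0∞, 0 < δ ∧ ∀ Ψ Φ : TrialState N (sideLength ρ N),
          energy v Ψ ≤ groundStateEnergy v N (sideLength ρ N) + δ →
          energy v Φ ≤ groundStateEnergy v N (sideLength ρ N) + δ →
          ∃ c : ℂ, ‖c‖ = 1 ∧ ∫⁻ X, (‖Ψ.ψ X - c * Φ.ψ X‖₊ : ℝ≥0∞) ^ 2 ≤ ENNReal.ofReal η := by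
  intro v hv hlb ρ hρ
  filter_upwards [eventually_ge_atTop 1] with N hN
  exact rigid_of_essLocBdd' N v (sideLength ρ N) hN (sideLength_pos_of_pos hρ hN) hv hlb

end Summit.AtomisticToContinuum.BoseEinsteinCondensation.Theorems.GroundStateRigidity

end
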